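import Literature.AnabelianGeometry.AbsoluteAnabelian.AbsTopICuspidalDecompositionSub
import HarnessLib

/-!
# [AbsTopI] Lemma 4.5 (iii)(iv)(v) SUB-DAG — the ALGEBRA sub-nodes, PROVED

Proof-only companion (abc-iut cell, layer L4, seat abc-iut-w5-d062) of
`AbsTopICuspidalDecompositionSub.lean` (SUB-DAG of [AbsTopI] Lemma 4.5 (iii)(iv)(v), table
`plan/L4/SUBDAG-AbsTopI-Lem45.md`): the sub-nodes marked ALGEBRA there — A1, A2, A4, A5, A6, A8, A11,
B5, C3 — are discharged (A10 `DualRankEq` in the sibling `…SubDualProofs.lean`) over Mathlib and the parent file `AbsTopICharacterRank.lean` (no étale π₁, no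
new `def … : Prop`).  Locators: [AbsTopI] (kurims `paper:url-11ac98ba15fc`) Lemma 4.5 pp. 53–55;
[CombGC] (kurims `paper:url-6994f81053dc`) Def. 2.3 p. 18, Prop. 2.4 pp. 19–20, Cor. 2.7 p. 23.
HONEST FRAMING: refereed pre-IUT anabelian geometry; typed ≠ proved for the remaining (INPUT) rows;
nothing here bears on [IUTchIII] Cor. 3.12.
-/

noncomputable section

open scoped Classical

namespace Literature.AnabelianGeometry.AbsoluteAnabelian.AbsTopI

universe u v w w'

section WeightsProofs

variable {G : Type u} [Group G] [TopologicalSpace G]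
variable {K : Type v} [Field K] {M : Type w} [AddCommGroup M] [Module K M]
variable {V : Type w'} [AddCommGroup V] [Module K V]

omit [TopologicalSpace G] in
/-- Weights ADD under products of `ℚ`-cyclotomic characters (`χ₁^{b₁} = c^{a₁}`, `χ₂^{b₂} = c^{a₂}` ⇒
`(χ₁χ₂)^{b₁b₂} = c^{a₁b₂ + a₂b₁}`). [cite: MochizukiCombGC2007, Def. 2.3 (ii) p.18] -/
theorem isQCyclotomicOfWeightK_mul {χcyclo χ₁ χ₂ : G →* Kˣ} {w₁ w₂ : ℚ}
    (h₁ : IsQCyclotomicOfWeightK χcyclo χ₁ w₁) (h₂ : IsQCyclotomicOfWeightK χcyclo χ₂ w₂) :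
    IsQCyclotomicOfWeightK χcyclo (χ₁ * χ₂) (w₁ + w₂) := by
  obtain ⟨a₁, b₁, hb₁, e₁, hw₁⟩ := h₁
  obtain ⟨a₂, b₂, hb₂, e₂, hw₂⟩ := h₂
  refine ⟨a₁ * b₂ + a₂ * b₁, b₁ * b₂, mul_pos hb₁ hb₂, fun g => ?_, ?_⟩
  · have h1 : χ₁ g ^ (b₁ * b₂) = χcyclo g ^ (a₁ * b₂) := by rw [zpow_mul, e₁, ← zpow_mul]
    have h2 : χ₂ g ^ (b₁ * b₂) = χcyclo g ^ (a₂ * b₁) := by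
      rw [mul_comm b₁ b₂, zpow_mul, e₂, ← zpow_mul]
    rw [MonoidHom.mul_apply, mul_zpow, h1, h2, ← zpow_add]
  · rw [hw₁, hw₂]
    have hb₁' : (b₁ : ℚ) ≠ 0 := by exact_mod_cast hb₁.ne'
    have hb₂' : (b₂ : ℚ) ≠ 0 := by exact_mod_cast hb₂.ne'
    push_cast
    field_simp

omit [TopologicalSpace G] in
/-- **SUB-NODE A1, PROVED** ([CombGC] Prop. 2.4 (iv), last sentence, in power-equivalence form): two
`ℚ`-cyclotomic characters of the same weight have a common positive power.
[cite: MochizukiCombGC2007, Prop. 2.4 (iv) p.19] [cite: MochizukiAbsTopI2012, Lemma 4.5 (iii) p.54] -/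
theorem sameWeightPowerEquivalent_holds (χcyclo : G →* Kˣ) : SameWeightPowerEquivalent χcyclo := by
  intro χ₁ χ₂ w ⟨a₁, b₁, hb₁, e₁, hw₁⟩ ⟨a₂, b₂, hb₂, e₂, hw₂⟩
  have hab : a₁ * b₂ = a₂ * b₁ := by
    have hb₁' : (b₁ : ℚ) ≠ 0 := by exact_mod_cast hb₁.ne'
    have hb₂' : (b₂ : ℚ) ≠ 0 := by exact_mod_cast hb₂.ne'
    have h : (2 * a₁ / b₁ : ℚ) = 2 * a₂ / b₂ := by rw [← hw₁, ← hw₂]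
    rw [div_eq_div_iff hb₁' hb₂'] at h
    have h' : ((a₁ * b₂ : ℤ) : ℚ) = ((a₂ * b₁ : ℤ) : ℚ) := by push_cast; linarith
    exact_mod_cast h'
  refine ⟨(b₁ * b₂).toNat, ?_, fun g => ?_⟩
  · have : 0 < b₁ * b₂ := mul_pos hb₁ hb₂
    omega
  · have hn : (((b₁ * b₂).toNat : ℕ) : ℤ) = b₁ * b₂ := Int.toNat_of_nonneg (mul_pos hb₁ hb₂).le
    have h1 : χ₁ g ^ (b₁ * b₂) = χcyclo g ^ (a₁ * b₂) := by rw [zpow_mul, e₁, ← zpow_mul]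
    have h2 : χ₂ g ^ (b₁ * b₂) = χcyclo g ^ (a₂ * b₁) := by
      rw [mul_comm b₁ b₂, zpow_mul, e₂, ← zpow_mul]
    rw [← zpow_natCast, ← zpow_natCast, hn, h1, h2, hab]

omit [TopologicalSpace G] in
/-- **SUB-NODE A5, PROVED**: `χ^{cyclo}` has weight `2`, the trivial character weight `0`.
[cite: MochizukiCombGC2007, Def. 2.3 (ii) p.18] -/
theorem cycloWeightTwoTrivialWeightZero_holds (χcyclo : G →* Kˣ) :
    CycloWeightTwoTrivialWeightZero χcyclo := by
  refine ⟨⟨1, 1, one_pos, fun g => rfl, by norm_num⟩, ⟨0, 1, one_pos, fun g => ?_, by norm_num⟩⟩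
  simp

/-- **SUB-NODE A4, PROVED** ("(iv) follows formally from (iii) … `ℤ_l^×` contains a torsion-free
open subgroup"): if `det(V)^2 = (χ^{cyclo})^m` on an open subgroup of finite index (`m > 0`), then
the determinant character is `ℚ`-cyclotomic of the positive weight `m` in the EXACT sense of
[AbsTopI] p. 54 (raise to the index of the normal core to kill the finite quotient).
[cite: MochizukiCombGC2007, Prop. 2.4 (iv) p.19] [cite: MochizukiAbsTopI2012, Lemma 4.5 (iii) p.54] -/
theorem detQCyclotomicOfDetSq_holds [FiniteDimensional K V] (χcyclo : G →* Kˣ)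
    (ρV : G →* (V ≃ₗ[K] V)) : DetQCyclotomicOfDetSq χcyclo ρV := by
  rintro ⟨m, hm, -, U, -, hUfi, hU⟩
  haveI := hUfi
  -- the normal core `N` of `U` has finite index `k`, and `g ^ k ∈ N ≤ U` for every `g`
  let N := U.normalCore
  haveI : N.FiniteIndex := Subgroup.finiteIndex_normalCore U
  set k := N.index with hk
  have hkpos : 0 < k := Nat.pos_of_ne_zero Subgroup.FiniteIndex.index_ne_zero
  have hpow : ∀ g : G, g ^ k ∈ U := fun g => U.normalCore_le (Subgroup.pow_index_mem N g)
  refine ⟨m, by exact_mod_cast hm, m * k, 2 * k, by positivity, fun g => ?_, ?_⟩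
  · have h := hU (g ^ k) (hpow g)
    rw [map_pow, map_pow, ← pow_mul, ← pow_mul] at h
    rw [show (2 * (k : ℤ)) = ((k * 2 : ℕ) : ℤ) by push_cast; ring,
      show ((m : ℤ) * (k : ℤ)) = ((k * m : ℕ) : ℤ) by push_cast; ring, zpow_natCast, zpow_natCast]
    exact h
  · have hk' : (k : ℚ) ≠ 0 := by exact_mod_cast hkpos.ne'
    push_cast
    rw [eq_div_iff (by positivity)]
    ring

/-- **SUB-NODE A6, PROVED**: the weight `0` is realised by `V ⊕ ℚ_l` — the chain
`V ⊕ ℚ_l ⊇ 0 ⊕ ℚ_l ⊇ 0` has the quasi-trivial step `0 ⊕ ℚ_l ⊇ 0` of dimension `1`.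
[cite: MochizukiAbsTopI2012, Lemma 4.5 (iii) p.54] -/
theorem zeroWeightRealised_holds [FiniteDimensional K V] (χcyclo : G →* Kˣ)
    (ρV : G →* (V ≃ₗ[K] V)) : ZeroWeightRealised χcyclo ρV := by
  refine ⟨1, (cycloWeightTwoTrivialWeightZero_holds χcyclo).2, ?_⟩
  have hinv : (1 : G →* Kˣ)⁻¹ = 1 := by ext g; simp
  rw [hinv, twist_one]
  -- the stable chain `⊤ ⊇ N ⊇ ⊥` with `N = 0 ⊕ K`
  let N : Submodule K (V × K) := LinearMap.range (LinearMap.inr K V K)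
  have hN : ∀ g : G, ∀ x ∈ N, withTrivial ρV g x ∈ N := by
    rintro g _ ⟨c, rfl⟩
    refine ⟨c, ?_⟩
    simp [withTrivial]
  let ch : StableChain (withTrivial ρV) :=
    { length := 2
      term := fun j => if j = 0 then ⊤ else if j = 1 then N else ⊥
      term_zero := by simp
      term_length := by simp
      step_le := by
        intro j hj
        interval_cases j <;> simp
      stable := by
        intro j g x hx
        by_cases h0 : j = 0
        · subst h0; simp
        · by_cases h1 : j = 1
          · subst h1
            simp only [if_neg one_ne_zero, if_true] at hx ⊢
            exact hN g x hx
          · simp only [h0, h1, if_false, Submodule.mem_bot] at hx ⊢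
            rw [hx, map_zero] }
  have hstep : IsQuasiTrivialStep (withTrivial ρV) (ch.term 1) (ch.term 2) := by
    refine ⟨⊤, isOpen_univ, inferInstance, fun g _ x hx => ?_⟩
    simp only [ch, if_neg one_ne_zero, if_true] at hx
    obtain ⟨c, rfl⟩ := hx
    simp [ch, withTrivial]
  have hdim : Module.finrank K (ch.term 1) - Module.finrank K (ch.term 2) = 1 := by
    show Module.finrank K N - Module.finrank K (⊥ : Submodule K (V × K)) = 1
    rw [finrank_bot, Nat.sub_zero, LinearMap.finrank_range_of_inj LinearMap.inr_injective,
      Module.finrank_self]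
  have hle : 1 ≤ ch.qtDim := by
    unfold StableChain.qtDim
    have hmem : (1 : ℕ) ∈ Finset.range ch.length := by simp [ch]
    refine le_trans ?_ (Finset.single_le_sum (fun j _ => Nat.zero_le _) hmem)
    rw [if_pos hstep, hdim]
  have := hle.trans ch.qtDim_le_quasiTrivialRank
  omega

/-- **SUB-NODE A2, PROVED** for continuous characters with values in a `T₁` topological field: the
`l`-weight-`w` rank does not depend on the `ℚ`-cyclotomic character of weight `w` used to compute it
(A1 + the mechanism of [AbsTopI] Lemma 4.5 (ii), `quasiTrivialRank_twist_eq`).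
[cite: MochizukiCombGC2007, Def. 2.3 (ii) p.18] [cite: MochizukiAbsTopI2012, Lemma 4.5 (ii) p.54] -/
theorem weightRankIndependent_holds [FiniteDimensional K M] [IsTopologicalGroup G]
    [TopologicalSpace K] [T1Space K] [ContinuousMul K] (χcyclo : G →* Kˣ)
    (ρ : G →* (M ≃ₗ[K] M)) : WeightRankIndependent χcyclo ρ := by
  intro w ψ ψ' hψ hψ' h h'
  have e : dChi ρ ψ = dChi ρ ψ' :=
    dChi_eq_of_powerEquivalent ρ hψ hψ' (sameWeightPowerEquivalent_holds χcyclo ψ ψ' w h h')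
  unfold dChi at e
  have := congrArg (fun z : ℤ => z + quasiTrivialRank (dualRep ρ)) e
  simp only [sub_add_cancel] at this
  exact_mod_cast this

/-- **SUB-NODE A8, PROVED** (assembly of (iii), second sentence): symmetric finite realised weights
with `0` realised have maximum `w^*` and minimum `w_*` with `w^* + w_* = 2`; any product of realisers
has weight `2` = weight of `χ^{cyclo}`, hence is power-equivalent to it by A1.
[cite: MochizukiCombGC2007, Cor. 2.7 (i) proof p.23] [cite: MochizukiAbsTopI2012, Lemma 4.5 (iii) p.54] -/
theorem cycloClassOfSymmetry_holds (χcyclo : G →* Kˣ) (ρV : G →* (V ≃ₗ[K] V)) :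
    CycloClassOfSymmetry χcyclo ρV := by
  intro hA1 hA5 hA6 hA7
  obtain ⟨hfin, hsym⟩ := hA7
  set S : Set ℚ := {w | RealisedWeight χcyclo ρV w} with hS
  have hne : S.Nonempty := ⟨0, hA6⟩
  obtain ⟨wmax, hmax⟩ := Set.exists_max_image S id hfin hne
  obtain ⟨wmin, hmin⟩ := Set.exists_min_image S id hfin hne
  have hgreat : IsGreatest S wmax := ⟨hmax.1, fun w hw => hmax.2 w hw⟩
  have hleast : IsLeast S wmin := ⟨hmin.1, fun w hw => hmin.2 w hw⟩
  have hsum : wmax + wmin = 2 := by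
    have h1 : 2 - wmax ∈ S := (hsym wmax).1 hmax.1
    have h2 : 2 - wmin ∈ S := (hsym wmin).1 hmin.1
    have := hleast.2 h1
    have := hgreat.2 h2
    linarith
  refine ⟨wmax, wmin, hgreat, hleast, fun χup χlow hup _ hlow _ => ?_⟩
  have hprod : IsQCyclotomicOfWeightK χcyclo (χup * χlow) 2 := by
    have := isQCyclotomicOfWeightK_mul hup hlow
    rwa [hsum] at this
  obtain ⟨n, hn, h⟩ := hA1 (χup * χlow) χcyclo 2 hprod hA5.1
  exact ⟨n, hn, fun g => (h g).symm⟩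

/-- **SUB-NODE A11, PROVED** (assembly of (iii), third sentence): from the weight count A9 and the
duality A10, `numCusps = d_{χ^{cyclo}}(V) + 1`. [cite: MochizukiAbsTopI2012, Lemma 4.5 (iii) p.54] -/
theorem cuspCountOfWeights_holds [FiniteDimensional K V] (χcyclo : G →* Kˣ)
    (ρV : G →* (V ≃ₗ[K] V)) (numCusps : ℕ) : CuspCountOfWeights χcyclo ρV numCusps := by
  intro hA9 hA10
  unfold Lem45iii_cuspCount dChi
  unfold CuspCountViaWeights at hA9
  unfold DualRankEq at hA10
  rw [hA10]
  linarith

end WeightsProofs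



end Literature.AnabelianGeometry.AbsoluteAnabelian.AbsTopI

namespace Literature.AnabelianGeometry.AbsoluteAnabelian.FundamentalExtension

open scoped Pointwise

universe u

section CuspInertiaProofs

variable {Hstar : Type u} [Group Hstar] [TopologicalSpace Hstar] [IsTopologicalGroup Hstar]
variable (C : CuspInertiaData Hstar)

/-- **SUB-NODE B5, PROVED** (assembly of (iv) [amended]): the dictionary `r = d + 1` (B2), the
Riemann–Hurwitz criterion (B3) and the maximality characterisation (B4) identify the cusp inertia
subgroups of `H_*` with the parent predicate `IsMaximalCuspidalCandidate l d`.
[cite: MochizukiAbsTopI2012, Lemma 4.5 (iv) p.54] [cite: Mochizuki2012, IUTchI Rmk 1.2.2 (ii) p.40] -/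
theorem lem45ivOfSubnodes_holds (l : ℕ) (d : CuspCountData Hstar) : C.Lem45ivOfSubnodes l d := by
  intro hB2 hB3 hB4 I
  -- the criterion of B4 and `SatisfiesCuspidalCriterion` agree on every closed procyclic `I`
  have key : ∀ I : Subgroup Hstar,
      (IsClosed (I : Set Hstar) ∧ AbsTopII.IsFreeProSigmaCyclic {l} ↥I ∧
        ∀ J : Subgroup Hstar, J.Characteristic → IsOpen (J : Set Hstar) → J ≠ I ⊔ J →
          C.TotallyRamifiedAtSomeCusp (I ⊔ J) J) ↔ SatisfiesCuspidalCriterion l d I := by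
    intro I
    unfold SatisfiesCuspidalCriterion
    refine ⟨fun ⟨hc, hz, h⟩ => ⟨hc, hz, fun J hJ hJo hne => ?_⟩,
      fun ⟨hc, hz, h⟩ => ⟨hc, hz, fun J hJ hJo hne => ?_⟩⟩
    · have hr := (hB3 I J hc hz hJ hJo hne).1 (h J hJ hJo hne)
      have ho1 : IsOpen ((I ⊔ J : Subgroup Hstar) : Set Hstar) :=
        Subgroup.isOpen_mono le_sup_right hJo
      have ho2 : IsOpen ((Subgroup.closure ((fun x : Hstar => x ^ l) '' (I : Set Hstar)) ⊔ J :
          Subgroup Hstar) : Set Hstar) := Subgroup.isOpen_mono le_sup_right hJo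
      rw [hB2 _ ho1, hB2 _ ho2] at hr
      omega
    · apply (hB3 I J hc hz hJ hJo hne).2
      have ho1 : IsOpen ((I ⊔ J : Subgroup Hstar) : Set Hstar) :=
        Subgroup.isOpen_mono le_sup_right hJo
      have ho2 : IsOpen ((Subgroup.closure ((fun x : Hstar => x ^ l) '' (I : Set Hstar)) ⊔ J :
          Subgroup Hstar) : Set Hstar) := Subgroup.isOpen_mono le_sup_right hJo
      rw [hB2 _ ho1, hB2 _ ho2]
      have := h J hJ hJo hne
      omega
  rw [hB4 I]
  unfold IsMaximalCuspidalCandidate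
  rw [key I]
  refine and_congr_right fun _ => forall_congr' fun I' => ?_
  rw [key I']
  constructor
  · intro h hI' hle
    exact h hle hI'
  · intro h hle hI'
    exact h hI' hle

omit [IsTopologicalGroup Hstar] in
/-- **SUB-NODE C3, PROVED** ((v), first sentence, from C1): cusps ↔ conjugacy classes of cusp
inertia subgroups is a bijection. [cite: MochizukiAbsTopI2012, Lemma 4.5 (v) p.55]
[cite: MochizukiCombGC2007, Prop. 1.2 (i) p.8] -/
theorem cuspsBijInertiaClasses_of_distinct (h : C.DistinctCuspsNotCommensurable) :
    C.CuspsBijInertiaClasses := by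
  refine ⟨fun x y g hxy => h x y g ?_, fun I hI => hI⟩
  rw [hxy, inf_idem]
  have : (C.inertia y).subgroupOf (C.inertia y) = ⊤ := Subgroup.subgroupOf_self _
  rw [this]
  exact isOpen_univ

end CuspInertiaProofs

end Literature.AnabelianGeometry.AbsoluteAnabelian.FundamentalExtension

end
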